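import Literature.MathematicalPhysics.KineticTheory.HardSphereEuler
import Literature.MathematicalPhysics.KineticTheory.FouriersLaw
import Literature.MathematicalPhysics.StatisticalMechanics.Crystallization
import Literature.MathematicalPhysics.QuantumManyBody.BoseEinsteinCondensation
import HarnessLib

/-!
# AtomisticToContinuum / Crystallization — sub-problem statement (D-0017)

Moved out of `Summits/AtomisticToContinuum/Statement.lean` with the declaration text unchanged.
-/

/-- Conjunct `Crystallization` of `AtomisticToContinuum`: the Literature statement
`Literature.MathematicalPhysics.StatisticalMechanics.Crystallization`
(`Literature/MathematicalPhysics/StatisticalMechanics/Crystallization.lean`), imported not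
restated — Lennard-Jones in `ℝ³`: ground-state energy per particle converges to the (attained)
periodic minimum, and ground states converge locally, after extraction of a subsequence and up to
translations, to a non-zero lattice-periodic configuration. [cite: BlancLewin2015, §2.1 (15)–(18)]
[problem: hilbert6] -/
abbrev Crystallization : Prop := Literature.MathematicalPhysics.StatisticalMechanics.Crystallization
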